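import Literature.NumberTheory.LFunctions.JointEulerProductDenseness
import Literature.NumberTheory.LFunctions.ClassGroupDegreeOneTheta
import Literature.NumberTheory.LFunctions.ClassGroupEulerProductMeanSquare
import Literature.NumberTheory.LFunctions.PrimeIdealCountDegreeOne
import HarnessLib

/-!
# Joint denseness of twisted finite Euler products of class group `L`-functions (quadratic fields)

Topic `Literature/NumberTheory/LFunctions` (namespace `Literature.NumberTheory.LFunctions.NumberField`,
helpers in the sub-namespace `ClassGroupJointDenseness`).  Everything here is PROVED (one
definition with body, theorems; no named facts).

Let `K` be a quadratic field, `χ₁, …, χₙ` class group characters of `K` which are pairwise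
non-equivalent (`χᵢ ≠ χⱼ`, `χᵢ ≠ χⱼ⁻¹` for `i ≠ j`), `0 < r < R`, `1/2 < σ₀ − r`, `σ₀ + r < 1`,
`fᵢ` analytic on `|s − σ₀| < R`, `η > 0`, `y ∈ ℕ`.  Then there are a finite set `M` of rational
primes containing every prime `p ≤ y` and unimodular `b_p` (`p ∈ M`) such that simultaneously
for all `i` and all `|s − σ₀| ≤ r`

  `‖Σ_{p ∈ M} Σ_{𝔮 ∣ p} −log(1 − χᵢ(𝔮) b_p^{f(𝔮)} N𝔮^{−s}) − fᵢ(s)‖ < η`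

(`exists_joint_classLogSum_near`; the phase of a prime ideal `𝔮` of norm `p^f` is `b_p^f`, written
`powPhase b (N𝔮)`), and the corresponding statement for the Euler products and zero-free targets
(`exists_joint_classEulerProduct_near`).  This is the joint denseness lemma of Voronin's joint
universality theorem for the `L`-functions of the ideal classes of a quadratic field
[Voronin 1976/1977; Karatsuba–Voronin, *The Riemann Zeta-Function*, Ch. VII §3], in the form
used on discs by the tree (`JointDenseness.exists_joint_logSum_near` for Dirichlet characters,
Pańkowski 2010 Remark 2.1 / Steuding Thm. 5.10).

## Proof

The proof of `JointDenseness.exists_joint_logSum_near`, run with the vectors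
`u_p = (a_{χᵢ}(p) (p^{−s})_k)ᵢ ∈ ⊕ᵢ ℓ²`, `a_χ(p) = Σ_{N𝔮 = p} χ(𝔮)` (the degree-one primes above
`p`; `|a_χ(p)| ≤ 2`).  Pechersky's rearrangement theorem needs `Σ_p |⟨u_p, φ⟩| = ∞` for `φ ≠ 0`.
Here `⟨u_p, φ⟩ = p^{−σ₀} Σ_{N𝔮 = p} Φ_{[𝔮]}(log p)` with the entire functions
`Φ_C = Σᵢ conj(χᵢ(C)) ϱ_{φᵢ}` of exponential type.  In a quadratic field the ideals of prime norm
`p` are: none, one (`𝔮² = (p)`, so `[𝔮]² = 1`), or two (`𝔮𝔮' = (p)`, so `[𝔮'] = [𝔮]⁻¹`)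
(`mk0_mul_mk0_eq_one_of_ne`, `mk0_sq_eq_one_of_card_eq_one` — from `N((p)) = p²` alone); hence
`|⟨u_p, φ⟩| ≥ ½ w_C(p) p^{−σ₀} |Ψ_C(log p)|` with `Ψ_C = Φ_C + Φ_{C⁻¹}` and
`w_C(p) = #{𝔮 : N𝔮 = p, [𝔮] = C}`.  If the series converged, the weighted core
`entire_eq_zero_of_summable_wprimes` (Bayart–Matheron Lemmas 11.15–11.16), fed with the prime
number theorem for the degree-one primes of the class `C`
(`classDegreeOne_thetaW_sub_le_logPow`), would give `Ψ_C ≡ 0` for every class `C`, i.e.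
`Σᵢ conj(ϱ_{φᵢ}(z)) (χᵢ + χᵢ⁻¹) = 0` on `Cl_K`; by orthogonality of characters and the pairwise
non-equivalence this forces every `ϱ_{φᵢ} ≡ 0`, so `φ = 0`.  The quadratic tails
`Σ_{𝔮 ∣ p}(−log(1 − χ(𝔮) b^{f} N𝔮^{−s})) − b a_χ(p) p^{−s} = O(p^{−2σ})` are handled as in the
Dirichlet case.

## Main results

* `ClassGroupJointDenseness.mk0_mul_mk0_eq_one_of_ne`, `…mk0_sq_eq_one_of_card_eq_one`,
  `…card_idealsOfNorm_prime_le_two` — the ideals of prime norm in a quadratic field;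
* `ClassGroupJointDenseness.eq_zero_of_sum_add_inv_eq_zero` — `Σᵢ cᵢ (χᵢ + χᵢ⁻¹) = 0 ⇒ c = 0`
  for pairwise non-equivalent characters;
* `exists_joint_classLogSum_near`, `exists_joint_classEulerProduct_near` — joint denseness.

## References

* S. M. Voronin, *On the functional independence of Dirichlet L-functions*, Acta Arith. 27
  (1975) 493–503; *Analytic properties of generating functions of arithmetical objects*, thesis,
  Steklov 1977. A. A. Karatsuba, S. M. Voronin, *The Riemann Zeta-Function*, de Gruyter 1992,
  Ch. VII §3.
* [Steuding2007] J. Steuding, *Value-Distribution of L-Functions*, LNM 1877, Thm. 5.10, §1.4.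
* [BayartMatheron2009] F. Bayart, É. Matheron, *Dynamics of Linear Operators*, Lemmas 11.15–11.16.
* [Pankowski2010] Ł. Pańkowski, Acta Arith. 141 (2010), Remark 2.1.
-/

noncomputable section

open scoped NumberField nonZeroDivisors
open NumberField Complex Filter Topology Set Metric Finset
open Literature.NumberTheory.LFunctions.VoroninModel
open Literature.NumberTheory.LFunctions.ExpTypePrimeSums (thetaW)
open Literature.NumberTheory.NumberFields (natPrimeUnder natPrimeUnder_prime liesOver_natPrimeUnder
  mem_primesOver_iff_natPrimeUnder ne_bot_of_mem_primesOver natPrimeUnder_eq_of_liesOver)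

namespace Literature.NumberTheory.LFunctions.NumberField

variable {K : Type*} [Field K] [NumberField K]

/-! ### Phases attached to prime powers -/

/-- The phase of a prime power `m = p^k` for unimodular `b_p` per rational prime: `b_p^k`
(`powPhase b m = b(minFac m)^{v_{minFac m}(m)}`; for `m = N𝔮` and `b_p = p^{−iτ}` this is
`N𝔮^{−iτ}`). [folklore] -/
def powPhase (b : ℕ → ℂ) (m : ℕ) : ℂ := b m.minFac ^ (m.factorization m.minFac)

/-- `powPhase b (p^k) = b_p^k` for `p` prime, `k ≥ 1`. [folklore] -/
theorem powPhase_prime_pow (b : ℕ → ℂ) {p k : ℕ} (hp : p.Prime) (hk : k ≠ 0) :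
    powPhase b (p ^ k) = b p ^ k := by
  rw [powPhase, Nat.pow_minFac hk, hp.minFac_eq, Nat.factorization_pow_self hp]

/-- `|powPhase b m| = 1` for unimodular `b`. [folklore] -/
theorem norm_powPhase {b : ℕ → ℂ} (hb : ∀ p, ‖b p‖ = 1) (m : ℕ) : ‖powPhase b m‖ = 1 := by
  rw [powPhase, norm_pow, hb, one_pow]

/-- `powPhase 1 = 1`. [folklore] -/
theorem powPhase_one (m : ℕ) : powPhase (fun _ ↦ (1 : ℂ)) m = 1 := by
  rw [powPhase, one_pow]

namespace ClassGroupJointDenseness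

/-! ### The primes above a rational prime, their norms -/

/-- The norm of a nonzero prime `Q` is `p^k`, `p = natPrimeUnder Q`, `k ≥ 1`. [folklore] -/
theorem exists_absNorm_eq_pow {Q : Ideal (𝓞 K)} (hQ : Q.IsPrime) (hQ0 : Q ≠ ⊥) :
    ∃ k : ℕ, k ≠ 0 ∧ Ideal.absNorm Q = natPrimeUnder Q ^ k := by
  obtain ⟨p, k, hp, hk, hpk⟩ := isPrimePow_absNorm hQ hQ0
  have hp' : p.Prime := Nat.prime_iff.mpr hp
  have hdvd : p ∣ Ideal.absNorm Q := by rw [← hpk]; exact dvd_pow_self p hk.ne'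
  have hpq : p = natPrimeUnder Q := ClassEulerProduct.eq_natPrimeUnder_of_prime_dvd hQ hQ0 hp' hdvd
  exact ⟨k, hk.ne', by rw [← hpq, hpk]⟩

/-- The finset of primes of `𝓞 K` above the rational prime `p`. [folklore] -/
abbrev primesOverNat (K : Type*) [Field K] [NumberField K] (p : ℕ) : Finset (Ideal (𝓞 K)) :=
  IsDedekindDomain.primesOverFinset (Ideal.span {(p : ℤ)}) (𝓞 K)

/-- Membership in `primesOverNat K p` (`p` prime): nonzero primes `Q` with `natPrimeUnder Q = p`. [folklore] -/
theorem mem_primesOverNat_iff {p : ℕ} (hp : p.Prime) {Q : Ideal (𝓞 K)} :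
    Q ∈ primesOverNat K p ↔ Q.IsPrime ∧ Q ≠ ⊥ ∧ natPrimeUnder Q = p := by
  have hp0 : Ideal.span {(p : ℤ)} ≠ ⊥ := by simp [hp.ne_zero]
  haveI := Fact.mk hp
  haveI : (Ideal.span {(p : ℤ)}).IsMaximal := Int.ideal_span_isMaximal_of_prime p
  rw [primesOverNat, IsDedekindDomain.mem_primesOverFinset_iff hp0]
  constructor
  · rintro ⟨h1, h2⟩
    have hmem : Q ∈ Ideal.primesOver (Ideal.span {(p : ℤ)}) (𝓞 K) := ⟨h1, h2⟩
    exact ⟨h1, ne_bot_of_mem_primesOver hp hmem, (mem_primesOver_iff_natPrimeUnder h1 p).mp hmem⟩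
  · rintro ⟨h1, -, h3⟩
    exact (mem_primesOver_iff_natPrimeUnder h1 p).mpr h3

/-- At most `2` primes above `p` in a quadratic field. [folklore] -/
theorem card_primesOverNat_le_two (h2 : Module.finrank ℚ K = 2) {p : ℕ} (hp : p.Prime) :
    (primesOverNat K p).card ≤ 2 := by
  have hp0 : Ideal.span {(p : ℤ)} ≠ ⊥ := by simp [hp.ne_zero]
  haveI := Fact.mk hp
  haveI : (Ideal.span {(p : ℤ)}).IsMaximal := Int.ideal_span_isMaximal_of_prime p
  have := Ideal.card_primesOverFinset_le_finrank (𝓞 K) ℚ K hp0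
  rw [h2] at this
  exact this

/-- An ideal of prime norm `p` is a prime above `p`. [folklore] -/
theorem mem_primesOverNat_of_absNorm_eq {p : ℕ} (hp : p.Prime) {I : Ideal (𝓞 K)} (hI : Ideal.absNorm I = p) :
    I ∈ primesOverNat K p := by
  have hirr : Irreducible (Ideal.absNorm I) := by rw [hI]; exact hp
  have hprime : I.IsPrime := Ideal.isPrime_of_irreducible_absNorm hirr
  have hI0 : I ≠ ⊥ := by intro h; rw [h, Ideal.absNorm_bot] at hI; exact hp.ne_zero hI.symm
  refine (mem_primesOverNat_iff hp).mpr ⟨hprime, hI0, ?_⟩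
  exact (ClassEulerProduct.eq_natPrimeUnder_of_prime_dvd hprime hI0 hp (by rw [hI])).symm

/-- The ideals of norm `p` are the members of `primesOverNat K p` of norm `p`. [folklore] -/
theorem idealsOfNorm_eq_filter {p : ℕ} (hp : p.Prime) :
    idealsOfNorm K p = (primesOverNat K p).filter (fun Q ↦ Ideal.absNorm Q = p) := by
  ext I
  rw [mem_idealsOfNorm, Finset.mem_filter]
  exact ⟨fun h ↦ ⟨mem_primesOverNat_of_absNorm_eq hp h, h⟩, fun h ↦ h.2⟩

/-! ### The ideals of prime norm in a quadratic field -/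

/-- `N((p)) = p²` in a quadratic field. [folklore] -/
theorem absNorm_span_natCast_eq_sq (h2 : Module.finrank ℚ K = 2) (p : ℕ) :
    Ideal.absNorm (Ideal.span {(p : 𝓞 K)}) = p ^ 2 := by
  rw [IdealNormCount.absNorm_span_natCast K p, h2]

/-- An ideal of norm `p` divides `(p)`. [folklore] -/
theorem span_natCast_le {p : ℕ} {I : Ideal (𝓞 K)} (hI : Ideal.absNorm I = p) :
    Ideal.span {(p : 𝓞 K)} ≤ I := by
  rw [Ideal.span_singleton_le_iff_mem]
  have := Ideal.absNorm_mem I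
  rw [hI] at this
  exact_mod_cast this

/-- Nonzero-divisor packaging of a nonzero ideal. [folklore] -/
abbrev nzd (I : Ideal (𝓞 K)) (hI : I ≠ ⊥) : (Ideal (𝓞 K))⁰ := ⟨I, mem_nonZeroDivisors_of_ne_zero hI⟩

/-- **Two distinct ideals of prime norm `p` multiply to `(p)`** (quadratic field). [folklore] -/
theorem mul_eq_span_of_ne (h2 : Module.finrank ℚ K = 2) {p : ℕ} (hp : p.Prime)
    {I J : Ideal (𝓞 K)} (hI : Ideal.absNorm I = p) (hJ : Ideal.absNorm J = p) (hIJ : I ≠ J) :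
    I * J = Ideal.span {(p : 𝓞 K)} := by
  have hIp : I.IsPrime := Ideal.isPrime_of_irreducible_absNorm (by rw [hI]; exact hp)
  have hJp : J.IsPrime := Ideal.isPrime_of_irreducible_absNorm (by rw [hJ]; exact hp)
  have hI0 : I ≠ ⊥ := by intro h; rw [h, Ideal.absNorm_bot] at hI; exact hp.ne_zero hI.symm
  have hJ0 : J ≠ ⊥ := by intro h; rw [h, Ideal.absNorm_bot] at hJ; exact hp.ne_zero hJ.symm
  have hIm : I.IsMaximal := hIp.isMaximal hI0
  have hJm : J.IsMaximal := hJp.isMaximal hJ0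
  have hcop : IsCoprime I J := Ideal.isCoprime_iff_sup_eq.mpr (hIm.coprime_of_ne hJm hIJ)
  have hIdvd : I ∣ Ideal.span {(p : 𝓞 K)} := Ideal.dvd_iff_le.mpr (span_natCast_le hI)
  have hJdvd : J ∣ Ideal.span {(p : 𝓞 K)} := Ideal.dvd_iff_le.mpr (span_natCast_le hJ)
  obtain ⟨M, hM⟩ := hcop.mul_dvd hIdvd hJdvd
  have hnorm := congrArg Ideal.absNorm hM
  rw [absNorm_span_natCast_eq_sq h2, map_mul, map_mul, hI, hJ] at hnorm
  have hM1 : Ideal.absNorm M = 1 := by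
    rw [sq] at hnorm
    have hpp : 0 < p * p := Nat.mul_pos hp.pos hp.pos
    exact (Nat.eq_of_mul_eq_mul_left hpp (show p * p * 1 = p * p * Ideal.absNorm M by
      rw [mul_one]; exact hnorm)).symm
  rw [Ideal.absNorm_eq_one_iff] at hM1
  rw [hM, hM1, Ideal.mul_top]

/-- **A unique ideal of prime norm `p` has square `(p)`** (quadratic field). [folklore] -/
theorem sq_eq_span_of_card_eq_one (h2 : Module.finrank ℚ K = 2) {p : ℕ} (hp : p.Prime)
    {I : Ideal (𝓞 K)} (hI : Ideal.absNorm I = p) (hcard : (idealsOfNorm K p).card = 1) :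
    I * I = Ideal.span {(p : 𝓞 K)} := by
  have hIdvd : I ∣ Ideal.span {(p : 𝓞 K)} := Ideal.dvd_iff_le.mpr (span_natCast_le hI)
  obtain ⟨M, hM⟩ := hIdvd
  have hnorm := congrArg Ideal.absNorm hM
  rw [absNorm_span_natCast_eq_sq h2, map_mul, hI, sq] at hnorm
  have hMp : Ideal.absNorm M = p := (Nat.eq_of_mul_eq_mul_left hp.pos hnorm).symm
  -- `M` and `I` are both the unique ideal of norm `p`
  obtain ⟨I₀, hI₀⟩ := Finset.card_eq_one.mp hcard
  have hII₀ : I = I₀ := by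
    have : I ∈ idealsOfNorm K p := mem_idealsOfNorm.mpr hI
    rw [hI₀] at this; exact Finset.mem_singleton.mp this
  have hMI₀ : M = I₀ := by
    have : M ∈ idealsOfNorm K p := mem_idealsOfNorm.mpr hMp
    rw [hI₀] at this; exact Finset.mem_singleton.mp this
  rw [hM, hMI₀, hII₀]

/-- The class of `(p)` is trivial. [folklore] -/
theorem mk0_span_natCast {p : ℕ} (hp : p.Prime) :
    ClassGroup.mk0 (nzd (Ideal.span {(p : 𝓞 K)}) (by
      rw [Ne, Ideal.span_singleton_eq_bot]; exact_mod_cast hp.ne_zero)) = 1 := by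
  rw [ClassGroup.mk0_eq_one_iff]
  exact ⟨⟨(p : 𝓞 K), rfl⟩⟩

/-- **Classes of two distinct ideals of prime norm are inverse to each other** (quadratic field).
[folklore] -/
theorem mk0_mul_mk0_eq_one_of_ne (h2 : Module.finrank ℚ K = 2) {p : ℕ} (hp : p.Prime)
    {I J : Ideal (𝓞 K)} (hI : Ideal.absNorm I = p) (hJ : Ideal.absNorm J = p) (hIJ : I ≠ J)
    (hI0 : I ≠ ⊥) (hJ0 : J ≠ ⊥) :
    ClassGroup.mk0 (nzd I hI0) * ClassGroup.mk0 (nzd J hJ0) = 1 := by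
  rw [← map_mul, ← mk0_span_natCast (K := K) hp]
  congr 1
  exact Subtype.ext (mul_eq_span_of_ne h2 hp hI hJ hIJ)

/-- **The class of a unique ideal of prime norm has order `≤ 2`** (quadratic field). [folklore] -/
theorem mk0_sq_eq_one_of_card_eq_one (h2 : Module.finrank ℚ K = 2) {p : ℕ} (hp : p.Prime)
    {I : Ideal (𝓞 K)} (hI : Ideal.absNorm I = p) (hcard : (idealsOfNorm K p).card = 1) (hI0 : I ≠ ⊥) :
    ClassGroup.mk0 (nzd I hI0) * ClassGroup.mk0 (nzd I hI0) = 1 := by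
  rw [← map_mul, ← mk0_span_natCast (K := K) hp]
  congr 1
  exact Subtype.ext (sq_eq_span_of_card_eq_one h2 hp hI hcard)

/-- At most two ideals of prime norm `p` (quadratic field). [folklore] -/
theorem card_idealsOfNorm_prime_le_two (h2 : Module.finrank ℚ K = 2) {p : ℕ} (hp : p.Prime) :
    (idealsOfNorm K p).card ≤ 2 := by
  rw [card_idealsOfNorm]
  have := idealNormCount_prime_le_finrank K hp
  rwa [h2] at this

/-! ### Characters: orthogonality and the non-equivalence argument -/

-- `sum_classGroupChar_eq_zero` (`Σ_C χ(C) = 0` for `χ ≠ 1`) is the tree's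
-- (`ClassGroupLFunctionEntire.lean`).

/-- **Orthogonality**: `Σ_C conj(χ₀(C)) χ(C) = h [χ = χ₀]`. [folklore] -/
theorem sum_conj_mul_classGroupChar (χ₀ χ : ClassGroup (𝓞 K) →* ℂˣ) :
    ∑ C : ClassGroup (𝓞 K), (starRingEnd ℂ) (χ₀ C : ℂ) * (χ C : ℂ) =
      if χ = χ₀ then (Fintype.card (ClassGroup (𝓞 K)) : ℂ) else 0 := by
  have hinv : ∀ C, (starRingEnd ℂ) (χ₀ C : ℂ) * (χ C : ℂ) =
      ((χ₀⁻¹ * χ : ClassGroup (𝓞 K) →* ℂˣ) C : ℂ) := by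
    intro C
    rw [MonoidHom.mul_apply, MonoidHom.inv_apply, Units.val_mul, Units.val_inv_eq_inv_val,
      Complex.inv_eq_conj (norm_classGroupChar_apply χ₀ C)]
  simp_rw [hinv]
  by_cases h : χ = χ₀
  · subst h
    rw [if_pos rfl]
    simp only [MonoidHom.mul_apply, MonoidHom.inv_apply, inv_mul_cancel, Units.val_one,
      Finset.sum_const, Finset.card_univ, nsmul_eq_mul, mul_one]
  · rw [if_neg h]
    refine sum_classGroupChar_eq_zero fun heq ↦ h (MonoidHom.ext fun C ↦ ?_)
    have := DFunLike.congr_fun heq C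
    rw [MonoidHom.mul_apply, MonoidHom.one_apply, MonoidHom.inv_apply, inv_mul_eq_one] at this
    exact this.symm

/-- **Non-equivalent characters**: if `χᵢ ≠ χⱼ` and `χᵢ ≠ χⱼ⁻¹` for `i ≠ j`, and
`Σᵢ cᵢ (χᵢ(C) + χᵢ⁻¹(C)) = 0` for all classes `C`, then `c = 0` (orthogonality: pairing with
`conj χ_{i₀}` isolates `c_{i₀} (1 + [χ_{i₀}² = 1]) h`). [folklore] -/
theorem eq_zero_of_sum_add_inv_eq_zero {ι : Type*} [Fintype ι] (χ : ι → (ClassGroup (𝓞 K) →* ℂˣ))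
    (hχ : Pairwise fun i j ↦ χ i ≠ χ j ∧ χ i ≠ (χ j)⁻¹) (c : ι → ℂ)
    (h : ∀ C : ClassGroup (𝓞 K), ∑ i, c i * ((χ i C : ℂ) + ((χ i)⁻¹ C : ℂ)) = 0) :
    ∀ i, c i = 0 := by
  classical
  intro i₀
  set hK : ℂ := (Fintype.card (ClassGroup (𝓞 K)) : ℂ) with hhK
  have hh : hK ≠ 0 := by rw [hhK]; exact_mod_cast Fintype.card_ne_zero
  -- pair with `conj χ_{i₀}` and swap the sums
  have hexp : ∑ i, c i * ((if χ i = χ i₀ then hK else 0) + (if (χ i)⁻¹ = χ i₀ then hK else 0)) = 0 := by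
    calc ∑ i, c i * ((if χ i = χ i₀ then hK else 0) + (if (χ i)⁻¹ = χ i₀ then hK else 0))
        = ∑ i, c i * ((∑ C : ClassGroup (𝓞 K), (starRingEnd ℂ) (χ i₀ C : ℂ) * (χ i C : ℂ)) +
            ∑ C : ClassGroup (𝓞 K), (starRingEnd ℂ) (χ i₀ C : ℂ) * ((χ i)⁻¹ C : ℂ)) := by
          simp only [sum_conj_mul_classGroupChar, hhK]
      _ = ∑ i, ∑ C : ClassGroup (𝓞 K), c i * ((starRingEnd ℂ) (χ i₀ C : ℂ) * (χ i C : ℂ) +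
            (starRingEnd ℂ) (χ i₀ C : ℂ) * ((χ i)⁻¹ C : ℂ)) := by
          refine Finset.sum_congr rfl fun i _ ↦ ?_
          rw [← Finset.sum_add_distrib, Finset.mul_sum]
      _ = ∑ C : ClassGroup (𝓞 K), (starRingEnd ℂ) (χ i₀ C : ℂ) *
            ∑ i, c i * ((χ i C : ℂ) + ((χ i)⁻¹ C : ℂ)) := by
          rw [Finset.sum_comm]
          refine Finset.sum_congr rfl fun C _ ↦ ?_
          rw [Finset.mul_sum]
          refine Finset.sum_congr rfl fun i _ ↦ ?_
          ring
      _ = 0 := by simp only [h, mul_zero, Finset.sum_const_zero]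
  rw [Finset.sum_eq_single i₀] at hexp
  · rw [if_pos rfl] at hexp
    have hne : hK + (if (χ i₀)⁻¹ = χ i₀ then hK else 0) ≠ 0 := by
      split_ifs
      · rw [← two_mul]; exact mul_ne_zero two_ne_zero hh
      · rwa [add_zero]
    exact (mul_eq_zero.mp hexp).resolve_right hne
  · intro i _ hi
    have h1 : χ i ≠ χ i₀ := (hχ hi).1
    have h2 : (χ i)⁻¹ ≠ χ i₀ := fun h' ↦ (hχ (Ne.symm hi)).2 h'.symm
    rw [if_neg h1, if_neg h2, add_zero, mul_zero]
  · intro h'; exact absurd (Finset.mem_univ i₀) h'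

/-! ### The coefficient `a_χ(p)` and the weights `w_C(p)` -/

/-- `a_χ(p) = Σ_{N𝔞 = p} χ([𝔞])` (`twistCount` of `ν_χ` at a prime `p`: the degree-one primes
above `p`). [folklore] -/
abbrev aCoeff (χ : ClassGroup (𝓞 K) →* ℂˣ) (p : ℕ) : ℂ := twistCount K (classGroupCharIdealHom χ) p

/-- `|a_χ(p)| ≤ 2` in a quadratic field. [folklore] -/
theorem norm_aCoeff_le (h2 : Module.finrank ℚ K = 2) (χ : ClassGroup (𝓞 K) →* ℂˣ) {p : ℕ}
    (hp : p.Prime) : ‖aCoeff χ p‖ ≤ 2 := by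
  refine (norm_twistCount_le (norm_classGroupCharIdealHom_le χ) p).trans ?_
  have := card_idealsOfNorm_prime_le_two (K := K) h2 hp
  rw [card_idealsOfNorm] at this
  exact_mod_cast this

/-- `conj(a_χ(p)) ϱ`-sums regroup over the ideals of norm `p`:
`Σᵢ conj(a_{χᵢ}(p)) gᵢ = Σ_{N𝔞 = p} Σᵢ conj(χᵢ([𝔞])) gᵢ`. [folklore] -/
theorem sum_conj_aCoeff_mul {ι : Type*} [Fintype ι] (χ : ι → (ClassGroup (𝓞 K) →* ℂˣ))
    (g : ι → ℂ) (p : ℕ) :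
    ∑ i, (starRingEnd ℂ) (aCoeff (χ i) p) * g i =
      ∑ I ∈ idealsOfNorm K p, ∑ i, (starRingEnd ℂ) (classGroupCharIdealHom (χ i) I) * g i := by
  simp only [aCoeff, twistCount, map_sum, Finset.sum_mul]
  exact Finset.sum_comm

/-- **The key inequality** (quadratic field): for every class `C₀`, prime `p` and values
`Φ : Cl_K → ℂ`, `½ w_{C₀}(p) |Φ(C₀) + Φ(C₀⁻¹)| ≤ |Σ_{N𝔞 = p} Φ([𝔞])|`. [folklore] -/
theorem half_weight_mul_norm_le (h2 : Module.finrank ℚ K = 2) (Φ : ClassGroup (𝓞 K) → ℂ)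
    (C₀ : ClassGroup (𝓞 K)) {p : ℕ} (hp : p.Prime) :
    (1 / 2 : ℝ) * (classNormIdealCount K C₀ p : ℝ) * ‖Φ C₀ + Φ C₀⁻¹‖ ≤
      ‖∑ I ∈ idealsOfNorm K p, (if h : I = ⊥ then 0 else Φ (ClassGroup.mk0 (nzd I h)))‖ := by
  classical
  -- the class of an ideal of norm `p`
  have hne : ∀ I ∈ idealsOfNorm K p, I ≠ ⊥ := fun I hI h ↦ by
    rw [mem_idealsOfNorm, h, Ideal.absNorm_bot] at hI; exact hp.ne_zero hI.symm
  by_cases hw : classNormIdealCount K C₀ p = 0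
  · rw [hw]; simp
  -- there is `I₀` of norm `p` in the class `C₀`
  obtain ⟨I₀, hI₀⟩ : ∃ I₀, I₀ ∈ (idealsOfNorm K p).filter (IdealInClass K C₀) :=
    Finset.nonempty_iff_ne_empty.mpr fun h ↦ hw (by rw [classNormIdealCount, h, Finset.card_empty])
  rw [Finset.mem_filter] at hI₀
  obtain ⟨hI₀mem, hI₀0, hI₀C⟩ := hI₀
  have hI₀N : Ideal.absNorm I₀ = p := mem_idealsOfNorm.mp hI₀mem
  have hwle : classNormIdealCount K C₀ p ≤ 2 :=
    (Finset.card_filter_le _ _).trans (card_idealsOfNorm_prime_le_two h2 hp)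
  have hcard_pos : 1 ≤ (idealsOfNorm K p).card := Finset.card_pos.mpr ⟨I₀, hI₀mem⟩
  have hcard2 := card_idealsOfNorm_prime_le_two (K := K) h2 hp
  -- case analysis on the number of ideals of norm `p`
  have hcard12 : (idealsOfNorm K p).card = 2 ∨ (idealsOfNorm K p).card = 1 := by omega
  rcases hcard12 with hcard | h1
  · -- two ideals: `{I₀, J}` with `[J] = C₀⁻¹`
    obtain ⟨A, B, hAB, hset⟩ := Finset.card_eq_two.mp hcard
    -- name the other ideal `J`
    obtain ⟨J, hJmem, hJne, hsetIJ⟩ : ∃ J, J ∈ idealsOfNorm K p ∧ J ≠ I₀ ∧ idealsOfNorm K p = {I₀, J} := by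
      have hI₀' : I₀ = A ∨ I₀ = B := by simpa [hset] using hI₀mem
      rcases hI₀' with rfl | rfl
      · exact ⟨B, by simp [hset], hAB.symm, hset⟩
      · exact ⟨A, by simp [hset], hAB, by rw [hset, Finset.pair_comm]⟩
    have hJN : Ideal.absNorm J = p := mem_idealsOfNorm.mp hJmem
    have hJ0 : J ≠ ⊥ := hne J hJmem
    have hJC : ClassGroup.mk0 (nzd J hJ0) = C₀⁻¹ := by
      have hmul := mk0_mul_mk0_eq_one_of_ne h2 hp hI₀N hJN hJne.symm hI₀0 hJ0
      rw [show ClassGroup.mk0 (nzd I₀ hI₀0) = C₀ from hI₀C] at hmul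
      exact eq_inv_of_mul_eq_one_right hmul
    have hsum : ∑ I ∈ idealsOfNorm K p, (if h : I = ⊥ then 0 else Φ (ClassGroup.mk0 (nzd I h))) =
        Φ C₀ + Φ C₀⁻¹ := by
      rw [hsetIJ, Finset.sum_pair hJne.symm, dif_neg hI₀0, dif_neg hJ0, hJC,
        show ClassGroup.mk0 (nzd I₀ hI₀0) = C₀ from hI₀C]
    rw [hsum]
    have hw2 : (classNormIdealCount K C₀ p : ℝ) ≤ 2 := by exact_mod_cast hwle
    calc (1 / 2 : ℝ) * (classNormIdealCount K C₀ p : ℝ) * ‖Φ C₀ + Φ C₀⁻¹‖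
        ≤ (1 / 2 : ℝ) * 2 * ‖Φ C₀ + Φ C₀⁻¹‖ := by gcongr
      _ = ‖Φ C₀ + Φ C₀⁻¹‖ := by ring
  · -- one ideal: `{I₀}`, `C₀² = 1`
    obtain ⟨A, hsetA⟩ := Finset.card_eq_one.mp h1
    have hA : A = I₀ := by
      have : I₀ ∈ ({A} : Finset (Ideal (𝓞 K))) := by rw [← hsetA]; exact hI₀mem
      exact (Finset.mem_singleton.mp this).symm
    have hset : idealsOfNorm K p = {I₀} := by rw [hsetA, hA]
    have hsq := mk0_sq_eq_one_of_card_eq_one h2 hp hI₀N h1 hI₀0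
    rw [show ClassGroup.mk0 (nzd I₀ hI₀0) = C₀ from hI₀C] at hsq
    have hinv : C₀⁻¹ = C₀ := (eq_inv_of_mul_eq_one_right hsq).symm
    have hsum : ∑ I ∈ idealsOfNorm K p, (if h : I = ⊥ then 0 else Φ (ClassGroup.mk0 (nzd I h))) =
        Φ C₀ := by
      rw [hset, Finset.sum_singleton, dif_neg hI₀0, show ClassGroup.mk0 (nzd I₀ hI₀0) = C₀ from hI₀C]
    have hw1 : classNormIdealCount K C₀ p ≤ 1 := by
      rw [classNormIdealCount]; exact (Finset.card_filter_le _ _).trans h1.le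
    have hw1' : (classNormIdealCount K C₀ p : ℝ) ≤ 1 := by exact_mod_cast hw1
    rw [hsum, hinv, ← two_mul, norm_mul, Complex.norm_two]
    calc (1 / 2 : ℝ) * (classNormIdealCount K C₀ p : ℝ) * (2 * ‖Φ C₀‖)
        ≤ (1 / 2 : ℝ) * 1 * (2 * ‖Φ C₀‖) := by gcongr
      _ = ‖Φ C₀‖ := by ring

/-! ### The local logarithms above a rational prime -/

/-- The twisted local logarithm of a prime ideal: `−log(1 − ν(𝔮) · e · N𝔮^{−s})`. [folklore] -/
abbrev logTermI (χ : ClassGroup (𝓞 K) →* ℂˣ) (e : ℂ) (Q : Ideal (𝓞 K)) (s : ℂ) : ℂ :=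
  -Complex.log (1 - classGroupCharIdealHom χ Q * e * ((Ideal.absNorm Q : ℕ) : ℂ) ^ (-s))

/-- `2 ≤ N𝔮` for `𝔮 ∈ primesOverNat K p`. [folklore] -/
theorem two_le_absNorm_of_mem_primesOverNat {p : ℕ} (hp : p.Prime) {Q : Ideal (𝓞 K)} (hQ : Q ∈ primesOverNat K p) :
    2 ≤ Ideal.absNorm Q := by
  obtain ⟨h1, h2, -⟩ := (mem_primesOverNat_iff hp).mp hQ
  exact two_le_absNorm_of_prime (Ideal.prime_of_isPrime h2 h1)

/-- The phase of `𝔮 ∈ primesOverNat K p` is `b_p^k`, `N𝔮 = p^k`. [folklore] -/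
theorem powPhase_absNorm_of_mem_primesOverNat (b : ℕ → ℂ) {p : ℕ} (hp : p.Prime) {Q : Ideal (𝓞 K)}
    (hQ : Q ∈ primesOverNat K p) : ∃ k : ℕ, k ≠ 0 ∧ Ideal.absNorm Q = p ^ k ∧ powPhase b (Ideal.absNorm Q) = b p ^ k := by
  obtain ⟨h1, h2, h3⟩ := (mem_primesOverNat_iff hp).mp hQ
  obtain ⟨k, hk, hN⟩ := exists_absNorm_eq_pow h1 h2
  rw [h3] at hN
  exact ⟨k, hk, hN, by rw [hN, powPhase_prime_pow b hp hk]⟩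

/-- Each local logarithm is differentiable in `s` (`Re s > 0`, `|e| ≤ 1`). [folklore] -/
theorem differentiableAt_logTermI (χ : ClassGroup (𝓞 K) →* ℂˣ) {e : ℂ} (he : ‖e‖ ≤ 1) {p : ℕ}
    (hp : p.Prime) {Q : Ideal (𝓞 K)} (hQ : Q ∈ primesOverNat K p) {s : ℂ} (hs : 0 < s.re) :
    DifferentiableAt ℂ (logTermI χ e Q) s := by
  have h2 := two_le_absNorm_of_mem_primesOverNat hp hQ
  have hb : ‖classGroupCharIdealHom χ Q * e‖ ≤ 1 := by
    rw [norm_mul]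
    calc ‖classGroupCharIdealHom χ Q‖ * ‖e‖ ≤ 1 * 1 := by
          gcongr
          · exact norm_classGroupCharIdealHom_le χ Q
      _ = 1 := one_mul _
  exact differentiableAt_logTerm h2 hb hs

/-- **The local logarithms above `p` minus their linear part are `O(p^{−2σ})`**: for `p` prime,
unimodular `b`, `Re s > 1/2`,
`‖Σ_{𝔮 ∣ p} −log(1 − ν(𝔮) b_p^{f(𝔮)} N𝔮^{−s}) − b_p a_χ(p) p^{−s}‖ ≤ 6 p^{−2 Re s}`
(quadratic field: at most two primes above `p`; a degree-one prime contributes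
`|−log(1−w) − w| ≤ 2|w|²`, a degree-`≥ 2` prime `|−log(1 − w)| ≤ |w| + 2|w|² ≤ 3p^{−2σ}`).
[cite: Steuding2007, Thm. 5.10 ((5.13)–(5.14))] -/
theorem norm_sum_logTermI_sub_le (h2 : Module.finrank ℚ K = 2) (χ : ClassGroup (𝓞 K) →* ℂˣ)
    {b : ℕ → ℂ} (hb : ∀ p, ‖b p‖ = 1) {p : ℕ} (hp : p.Prime) {s : ℂ} (hs : 1 / 2 < s.re) :
    ‖(∑ Q ∈ primesOverNat K p, logTermI χ (powPhase b (Ideal.absNorm Q)) Q s) -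
        b p * aCoeff χ p * (p : ℂ) ^ (-s)‖ ≤ 6 * (p : ℝ) ^ (-2 * s.re) := by
  classical
  have hp2 : 2 ≤ p := hp.two_le
  have hp0 : 0 < (p : ℝ) := by exact_mod_cast hp.pos
  have hσ0 : 0 < s.re := by linarith
  -- the linear part as a sum over `primesOverNat K p`
  have hlin : b p * aCoeff χ p * (p : ℂ) ^ (-s) =
      ∑ Q ∈ primesOverNat K p, (if Ideal.absNorm Q = p then
        classGroupCharIdealHom χ Q * b p * (p : ℂ) ^ (-s) else 0) := by
    rw [← Finset.sum_filter, ← idealsOfNorm_eq_filter hp, aCoeff, twistCount, Finset.mul_sum,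
      Finset.sum_mul]
    refine Finset.sum_congr rfl fun I _ ↦ by ring
  rw [hlin, ← Finset.sum_sub_distrib]
  -- termwise bound `3 p^{-2σ}`
  have hterm : ∀ Q ∈ primesOverNat K p, ‖logTermI χ (powPhase b (Ideal.absNorm Q)) Q s -
      (if Ideal.absNorm Q = p then classGroupCharIdealHom χ Q * b p * (p : ℂ) ^ (-s) else 0)‖ ≤
        3 * (p : ℝ) ^ (-2 * s.re) := by
    intro Q hQ
    obtain ⟨k, hk, hN, hph⟩ := powPhase_absNorm_of_mem_primesOverNat b hp hQ
    have hν : ‖classGroupCharIdealHom χ Q‖ ≤ 1 := norm_classGroupCharIdealHom_le χ Q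
    by_cases hdeg : Ideal.absNorm Q = p
    · -- degree one: `k = 1`
      rw [if_pos hdeg]
      have hk1 : k = 1 := by
        rw [hdeg] at hN
        exact Nat.pow_right_injective hp.two_le (show p ^ k = p ^ 1 by rw [pow_one]; exact hN.symm)
      rw [hk1, pow_one, hdeg] at hph
      simp only [logTermI, hdeg, hph]
      have hc : ‖classGroupCharIdealHom χ Q * b p‖ ≤ 1 := by
        rw [norm_mul, hb, mul_one]; exact hν
      calc ‖-Complex.log (1 - classGroupCharIdealHom χ Q * b p * (p : ℂ) ^ (-s)) -
            classGroupCharIdealHom χ Q * b p * (p : ℂ) ^ (-s)‖ ≤ 2 * (p : ℝ) ^ (-2 * s.re) :=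
            JointDenseness.norm_logTerm_sub_le' hp hc hs
        _ ≤ 3 * (p : ℝ) ^ (-2 * s.re) := by gcongr; norm_num
    · -- degree `k ≥ 2`
      rw [if_neg hdeg, sub_zero]
      have hk2 : 2 ≤ k := by
        rcases Nat.lt_or_ge k 2 with h | h
        · interval_cases k
          · exact absurd rfl hk
          · rw [pow_one] at hN; exact absurd hN hdeg
        · exact h
      set w : ℂ := classGroupCharIdealHom χ Q * powPhase b (Ideal.absNorm Q) *
        ((Ideal.absNorm Q : ℕ) : ℂ) ^ (-s) with hw
      have hNpos : 0 < Ideal.absNorm Q := by rw [hN]; exact pow_pos hp.pos k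
      have hwle : ‖w‖ ≤ (p : ℝ) ^ (-2 * s.re) := by
        rw [hw, norm_mul, norm_mul, norm_powPhase hb, mul_one,
          Complex.norm_natCast_cpow_of_pos hNpos, neg_re, hN]
        push_cast
        rw [← Real.rpow_natCast, ← Real.rpow_mul hp0.le]
        calc ‖classGroupCharIdealHom χ Q‖ * (p : ℝ) ^ ((k : ℝ) * -s.re)
            ≤ 1 * (p : ℝ) ^ ((k : ℝ) * -s.re) := by gcongr
          _ ≤ (p : ℝ) ^ (-2 * s.re) := by
              rw [one_mul]
              refine Real.rpow_le_rpow_of_exponent_le (by exact_mod_cast hp.one_lt.le) ?_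
              have : (2 : ℝ) ≤ k := by exact_mod_cast hk2
              nlinarith
      have hw34 : ‖w‖ ≤ 3 / 4 := by
        refine hwle.trans ?_
        have := rpow_neg_re_le hp2 hs
        calc (p : ℝ) ^ (-2 * s.re) ≤ (p : ℝ) ^ (-s.re) :=
              Real.rpow_le_rpow_of_exponent_le (by exact_mod_cast hp.one_lt.le) (by linarith)
          _ ≤ 3 / 4 := this
      have hlog := norm_neg_log_one_sub_sub_le_of_norm_le hw34
      have h1 : ‖-Complex.log (1 - w)‖ ≤ ‖w‖ + 2 * ‖w‖ ^ 2 := by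
        calc ‖-Complex.log (1 - w)‖ = ‖(-Complex.log (1 - w) - w) + w‖ := by ring_nf
          _ ≤ ‖-Complex.log (1 - w) - w‖ + ‖w‖ := norm_add_le _ _
          _ ≤ 2 * ‖w‖ ^ 2 + ‖w‖ := by gcongr
          _ = ‖w‖ + 2 * ‖w‖ ^ 2 := by ring
      show ‖-Complex.log (1 - w)‖ ≤ 3 * (p : ℝ) ^ (-2 * s.re)
      have h0 : 0 ≤ ‖w‖ := norm_nonneg _
      nlinarith [h1, hwle, hw34]
  calc ‖∑ Q ∈ primesOverNat K p, (logTermI χ (powPhase b (Ideal.absNorm Q)) Q s -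
        (if Ideal.absNorm Q = p then classGroupCharIdealHom χ Q * b p * (p : ℂ) ^ (-s) else 0))‖
      ≤ ∑ Q ∈ primesOverNat K p, 3 * (p : ℝ) ^ (-2 * s.re) := norm_sum_le_of_le _ hterm
    _ = (primesOverNat K p).card * (3 * (p : ℝ) ^ (-2 * s.re)) := by rw [Finset.sum_const, nsmul_eq_mul]
    _ ≤ 2 * (3 * (p : ℝ) ^ (-2 * s.re)) := by
        gcongr; exact_mod_cast card_primesOverNat_le_two h2 hp
    _ = 6 * (p : ℝ) ^ (-2 * s.re) := by ring

/-- With all phases `1` on the primes above `p`, `powPhase` is `1`. [folklore] -/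
theorem logTermI_powPhase_eq_of_eq_one {b : ℕ → ℂ} {p : ℕ} (hp : p.Prime) (hbp : b p = 1)
    (χ : ClassGroup (𝓞 K) →* ℂˣ) {Q : Ideal (𝓞 K)} (hQ : Q ∈ primesOverNat K p) (s : ℂ) :
    logTermI χ (powPhase b (Ideal.absNorm Q)) Q s = logTermI χ 1 Q s := by
  obtain ⟨k, -, -, hph⟩ := powPhase_absNorm_of_mem_primesOverNat b hp hQ
  rw [hph, hbp, one_pow]

end ClassGroupJointDenseness

open ClassGroupJointDenseness

set_option maxHeartbeats 4000000 in
/-- **Joint denseness of twisted finite Euler-product logarithms for pairwise non-equivalent class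
group characters of a quadratic field, log-sum form on discs** (Voronin 1976; Karatsuba–Voronin
Ch. VII §3; the class-group analogue of `JointDenseness.exists_joint_logSum_near`). Let `K` be
quadratic, `χᵢ` (`i ∈ ι`, finite) class group characters with `χᵢ ≠ χⱼ`, `χᵢ ≠ χⱼ⁻¹` (`i ≠ j`),
`0 < r < R`, `1/2 < σ₀ − r`, `σ₀ + r < 1`, `fᵢ` analytic on `|s − σ₀| < R`, `η > 0`, `y ∈ ℕ`.
Then there are `n ≥ y` and unimodular `b_p` such that for all `i` and `|s − σ₀| ≤ r`
`‖Σ_{p<n} Σ_{𝔮 ∣ p} −log(1 − χᵢ(𝔮) b_p^{f(𝔮)} N𝔮^{−s}) − fᵢ(s)‖ < η` (an initial segment of the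
rational primes, as in the tree's `exists_primesBelow_logSum_near`).
[cite: Steuding2007, Thm. 5.10 and §1.4 Thm. 1.10] [cite: BayartMatheron2009, Lemma 11.15, Lemma 11.16] -/
theorem exists_joint_classLogSum_near (h2 : Module.finrank ℚ K = 2) {ι : Type} [Fintype ι]
    (χ : ι → (ClassGroup (𝓞 K) →* ℂˣ))
    (hχ : Pairwise fun i j ↦ χ i ≠ χ j ∧ χ i ≠ (χ j)⁻¹)
    (σ₀ r R : ℝ) (hr : 0 < r) (hrR : r < R) (h1 : 1 / 2 < σ₀ - r) (h1' : σ₀ + r < 1)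
    (f : ι → ℂ → ℂ) (hf : ∀ i, DifferentiableOn ℂ (f i) (ball (σ₀ : ℂ) R))
    (η : ℝ) (hη : 0 < η) (y : ℕ) :
    ∃ n : ℕ, y ≤ n ∧ ∃ b : ℕ → ℂ, (∀ p, ‖b p‖ = 1) ∧
        ∀ i, ∀ s ∈ closedBall (σ₀ : ℂ) r,
          ‖(∑ p ∈ n.primesBelow, ∑ Q ∈ primesOverNat K p,
              logTermI (χ i) (powPhase b (Ideal.absNorm Q)) Q s) - f i s‖ < η := by
  classical
  /- radii `r < R₁ < R₂ < m = min R (σ₀ − 1/2) (1 − σ₀)` -/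
  set m : ℝ := min R (min (σ₀ - 1 / 2) (1 - σ₀)) with hm
  have hrm : r < m := lt_min hrR (lt_min (by linarith) (by linarith))
  have hmR : m ≤ R := min_le_left _ _
  have hmσ : m ≤ σ₀ - 1 / 2 := (min_le_right _ _).trans (min_le_left _ _)
  have hmσ' : m ≤ 1 - σ₀ := (min_le_right _ _).trans (min_le_right _ _)
  set R₁ : ℝ := (2 * r + m) / 3 with hR₁
  set R₂ : ℝ := (r + 2 * m) / 3 with hR₂
  have hrR₁ : r < R₁ := by rw [hR₁]; linarith
  have hR₁pos : 0 < R₁ := hr.trans hrR₁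
  have hR₁R₂ : R₁ < R₂ := by rw [hR₁, hR₂]; linarith
  have hR₂m : R₂ < m := by rw [hR₂]; linarith
  have hR₁σ' : σ₀ + R₁ < 1 := by linarith
  have hσ₀0 : 0 ≤ σ₀ := by linarith
  have hre : ∀ s ∈ closedBall (σ₀ : ℂ) R₂, 1 / 2 < s.re := by
    intro s hs
    rw [mem_closedBall, dist_eq_norm] at hs
    have h := (abs_re_le_norm (s - σ₀)).trans hs
    rw [sub_re, ofReal_re, abs_le] at h
    linarith [h.1]
  have hsub : closedBall (σ₀ : ℂ) R₂ ⊆ ball (σ₀ : ℂ) R :=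
    closedBall_subset_ball (hR₂m.trans_le hmR)
  /- Step 1: the cut-off `N` -/
  set c : ℝ := 2 * (σ₀ - r) with hc
  have hc1 : 1 < c := by rw [hc]; linarith
  set g : ℕ → ℝ := fun k ↦ 6 * (k : ℝ) ^ (-c) with hg
  have hg0 : ∀ k, 0 ≤ g k := fun k ↦ by positivity
  have hgs : Summable g := (Real.summable_nat_rpow.2 (by linarith)).mul_left 6
  have htail := tendsto_sum_nat_add g
  obtain ⟨N₀, hN₀⟩ := (Metric.tendsto_atTop.1 htail) (η / 3) (by positivity)
  set N : ℕ := max y N₀ with hN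
  have hyN : y ≤ N := le_max_left _ _
  have hN₀N : N₀ ≤ N + 1 := (le_max_right _ _).trans (Nat.le_succ N)
  have htailN : ∑' j : ℕ, g (j + (N + 1)) < η / 3 := by
    have h := hN₀ (N + 1) hN₀N
    rw [Real.dist_eq, sub_zero, abs_of_nonneg (tsum_nonneg fun j ↦ hg0 _)] at h
    exact h
  /- Step 2: the Hilbert-space data in `⊕ᵢ ℓ²` -/
  set qq : ℕ → ℕ := fun n ↦ (enumAbove N n : ℕ) with hqq
  have hq_prime : ∀ n, (qq n).Prime := fun n ↦ (enumAbove_spec N n).1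
  have hq_gt : ∀ n, N < qq n := fun n ↦ (enumAbove_spec N n).2
  have hq_pos : ∀ n, 0 < qq n := fun n ↦ (hq_prime n).pos
  have hq_inj : Function.Injective qq := enumAbove_injective N
  -- the vectors
  set x : ℕ → PiLp 2 (fun _ : ι ↦ lp (fun _ : ℕ ↦ ℂ) 2) := fun n ↦
    WithLp.toLp 2 (fun i ↦ (aCoeff (χ i) (qq n)) • cpowVec R₁ hR₁pos (qq n) (hq_pos n) (σ₀ : ℂ))
    with hx
  have hx_apply : ∀ n i, x n i = (aCoeff (χ i) (qq n)) • cpowVec R₁ hR₁pos (qq n) (hq_pos n) (σ₀ : ℂ) :=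
    fun n i ↦ rfl
  -- (i) `∑ ‖x n‖² < ∞`
  have hx1 : Summable (fun n ↦ ‖x n‖ ^ 2) := by
    have hmaj : Summable (fun n : ℕ ↦ (Fintype.card ι : ℝ) * (4 * ((qq n : ℕ) : ℝ) ^ (-2 * (σ₀ - R₁)))) := by
      have h := (Real.summable_nat_rpow.2 (by linarith : -2 * (σ₀ - R₁) < -1))
      exact ((h.comp_injective hq_inj).mul_left 4).mul_left _
    refine Summable.of_nonneg_of_le (fun n ↦ sq_nonneg _) (fun n ↦ ?_) hmaj
    rw [PiLp.norm_sq_eq_of_L2]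
    have hterm : ∀ i, ‖x n i‖ ^ 2 ≤ 4 * ((qq n : ℕ) : ℝ) ^ (-2 * (σ₀ - R₁)) := by
      intro i
      rw [hx_apply, norm_smul]
      have ha2 : ‖aCoeff (χ i) (qq n)‖ ≤ 2 := norm_aCoeff_le h2 (χ i) (hq_prime n)
      have hv := norm_cpowVec_sq_le hR₁pos (hq_pos n) (σ₀ : ℂ)
      simp only [ofReal_re] at hv
      calc (‖aCoeff (χ i) (qq n)‖ * ‖cpowVec R₁ hR₁pos (qq n) (hq_pos n) (σ₀ : ℂ)‖) ^ 2
          ≤ (2 * ‖cpowVec R₁ hR₁pos (qq n) (hq_pos n) (σ₀ : ℂ)‖) ^ 2 := by gcongr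
        _ = 4 * ‖cpowVec R₁ hR₁pos (qq n) (hq_pos n) (σ₀ : ℂ)‖ ^ 2 := by ring
        _ ≤ _ := by gcongr
    calc ∑ i, ‖x n i‖ ^ 2 ≤ ∑ _i : ι, 4 * ((qq n : ℕ) : ℝ) ^ (-2 * (σ₀ - R₁)) :=
          Finset.sum_le_sum fun i _ ↦ hterm i
      _ = (Fintype.card ι : ℝ) * (4 * ((qq n : ℕ) : ℝ) ^ (-2 * (σ₀ - R₁))) := by
          rw [Finset.sum_const, nsmul_eq_mul, Finset.card_univ]
  -- (ii) `∑ |⟨x n, φ⟩| = ∞` for `φ ≠ 0`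
  have hx2 : ∀ φ : PiLp 2 (fun _ : ι ↦ lp (fun _ : ℕ ↦ ℂ) 2), φ ≠ 0 →
      ¬ Summable (fun n ↦ ‖inner ℂ (x n) φ‖) := by
    intro φ hφ hsum
    apply hφ
    -- the entire functions `Φ_C`
    set Φ : ClassGroup (𝓞 K) → ℂ → ℂ := fun C z ↦
      ∑ i, (starRingEnd ℂ) (χ i C : ℂ) * pairing R₁ (φ i) z with hΦ
    have hinner : ∀ n, inner ℂ (x n) φ =
        ((((qq n : ℕ) : ℝ) ^ (-σ₀) : ℝ) : ℂ) *
          ∑ i, (starRingEnd ℂ) (aCoeff (χ i) (qq n)) * pairing R₁ (φ i) (Real.log (qq n)) := by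
      intro n
      rw [PiLp.inner_apply, Finset.mul_sum]
      refine Finset.sum_congr rfl fun i _ ↦ ?_
      rw [hx_apply, inner_smul_left, inner_cpowVec hR₁pos (hq_pos n) σ₀ (φ i)]
      ring
    -- regrouping over the ideals of norm `p`
    have hregroup : ∀ (p : ℕ) (z : ℂ), ∑ i, (starRingEnd ℂ) (aCoeff (χ i) p) * pairing R₁ (φ i) z =
        ∑ I ∈ idealsOfNorm K p, (if h : I = ⊥ then 0 else Φ (ClassGroup.mk0 (nzd I h)) z) := by
      intro p z
      rw [sum_conj_aCoeff_mul]
      refine Finset.sum_congr rfl fun I hI ↦ ?_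
      by_cases hI0 : I = ⊥
      · subst hI0; simp [classGroupCharIdealHom_bot]
      · rw [dif_neg hI0, hΦ]
        refine Finset.sum_congr rfl fun i _ ↦ ?_
        rw [classGroupCharIdealHom_apply_of_ne_bot _ hI0]
    have hΦd : ∀ C, Differentiable ℂ (Φ C) := fun C ↦ by
      rw [hΦ]; exact Differentiable.fun_sum fun i _ ↦ (differentiable_pairing hR₁pos (φ i)).const_mul _
    have hΦb : ∀ C z, ‖Φ C z‖ ≤ (∑ i, ‖φ i‖) * Real.exp (R₁ * ‖z‖) := by
      intro C z
      rw [hΦ, Finset.sum_mul]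
      refine (norm_sum_le _ _).trans (Finset.sum_le_sum fun i _ ↦ ?_)
      rw [norm_mul, RCLike.norm_conj, norm_classGroupChar_apply, one_mul]
      exact norm_pairing_le hR₁pos (φ i) z
    -- each `Ψ_C = ½(Φ_C + Φ_{C⁻¹})` vanishes
    have hΨ0 : ∀ C₀ : ClassGroup (𝓞 K), ∀ z, (1 / 2 : ℂ) * (Φ C₀ z + Φ C₀⁻¹ z) = 0 := by
      intro C₀
      have hhK : (0 : ℝ) < 1 / (Fintype.card (ClassGroup (𝓞 K)) : ℝ) := by
        have : (0 : ℝ) < Fintype.card (ClassGroup (𝓞 K)) := by exact_mod_cast Fintype.card_pos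
        positivity
      obtain ⟨C₃, hC₃⟩ := classDegreeOne_thetaW_sub_le_logPow (K := K) C₀ 3
      refine Literature.NumberTheory.LFunctions.entire_eq_zero_of_summable_wprimes hR₁pos hσ₀0 hR₁σ'
        (ρ := fun z ↦ (1 / 2 : ℂ) * (Φ C₀ z + Φ C₀⁻¹ z)) ?_ ?_
        (w := fun n ↦ (classNormIdealCount K C₀ n : ℝ)) (fun n ↦ Nat.cast_nonneg _) hhK
        (C₃ := C₃) (fun x hx ↦ by simpa [Real.rpow_natCast] using hC₃ x hx) ?_
      · exact ((hΦd C₀).add (hΦd C₀⁻¹)).const_mul _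
      · refine ⟨∑ i, ‖φ i‖, fun z ↦ ?_⟩
        rw [norm_mul]
        have h1 := hΦb C₀ z; have h2' := hΦb C₀⁻¹ z
        have : ‖Φ C₀ z + Φ C₀⁻¹ z‖ ≤ 2 * ((∑ i, ‖φ i‖) * Real.exp (R₁ * ‖z‖)) :=
          (norm_add_le _ _).trans (by linarith)
        calc ‖(1 / 2 : ℂ)‖ * ‖Φ C₀ z + Φ C₀⁻¹ z‖ ≤ (1 / 2) * (2 * ((∑ i, ‖φ i‖) * Real.exp (R₁ * ‖z‖))) := by
              gcongr; simp
          _ = (∑ i, ‖φ i‖) * Real.exp (R₁ * ‖z‖) := by ring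
      · -- the prime series over the class `C₀`
        set G : ℕ → ℝ := fun k ↦ (classNormIdealCount K C₀ k : ℝ) *
          ((k : ℝ) ^ (-σ₀) * ‖(1 / 2 : ℂ) * (Φ C₀ (Real.log k) + Φ C₀⁻¹ (Real.log k))‖) with hG
        have hG0 : ∀ k, 0 ≤ G k := fun k ↦ by positivity
        have hGle : ∀ n, G (qq n) ≤ ‖inner ℂ (x n) φ‖ := by
          intro n
          rw [hinner n, norm_mul, Complex.norm_real, Real.norm_eq_abs,
            abs_of_nonneg (Real.rpow_nonneg (Nat.cast_nonneg _) _), hregroup]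
          have hkey := half_weight_mul_norm_le h2 (fun C ↦ Φ C (Real.log (qq n))) C₀ (hq_prime n)
          simp only [hG, norm_mul]
          rw [show ‖(1 / 2 : ℂ)‖ = 1 / 2 by simp]
          have h0 : 0 ≤ ((qq n : ℕ) : ℝ) ^ (-σ₀) := Real.rpow_nonneg (Nat.cast_nonneg _) _
          calc (classNormIdealCount K C₀ (qq n) : ℝ) * (((qq n : ℕ) : ℝ) ^ (-σ₀) *
                (1 / 2 * ‖Φ C₀ (Real.log (qq n)) + Φ C₀⁻¹ (Real.log (qq n))‖))
              = ((qq n : ℕ) : ℝ) ^ (-σ₀) * ((1 / 2) * (classNormIdealCount K C₀ (qq n) : ℝ) *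
                  ‖Φ C₀ (Real.log (qq n)) + Φ C₀⁻¹ (Real.log (qq n))‖) := by ring
            _ ≤ ((qq n : ℕ) : ℝ) ^ (-σ₀) * ‖∑ I ∈ idealsOfNorm K (qq n),
                  (if h : I = ⊥ then 0 else Φ (ClassGroup.mk0 (nzd I h)) (Real.log (qq n)))‖ :=
                mul_le_mul_of_nonneg_left hkey h0
        have hS : Summable (fun n ↦ G (qq n)) :=
          Summable.of_nonneg_of_le (fun n ↦ hG0 _) hGle hsum
        have := summable_primes_of_summable_enumAbove N hS
        simpa only [hG] using this
    -- non-equivalence of the `χᵢ`: every `ϱ_{φ i}` vanishes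
    have hpair : ∀ i z, pairing R₁ (φ i) z = 0 := by
      intro i z
      have hz : ∀ C : ClassGroup (𝓞 K),
          ∑ j, (starRingEnd ℂ) (pairing R₁ (φ j) z) * ((χ j C : ℂ) + ((χ j)⁻¹ C : ℂ)) = 0 := by
        intro C
        have h0 := hΨ0 C z
        have h0' : Φ C z + Φ C⁻¹ z = 0 := by
          rcases mul_eq_zero.mp h0 with h | h
          · norm_num at h
          · exact h
        have h := congrArg (starRingEnd ℂ) h0'
        rw [map_add, hΦ, map_sum, map_sum, map_zero] at h
        rw [← h, ← Finset.sum_add_distrib]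
        refine Finset.sum_congr rfl fun j _ ↦ ?_
        have hu : (starRingEnd ℂ) (χ j C : ℂ) = ((χ j C : ℂ))⁻¹ :=
          (Complex.inv_eq_conj (norm_classGroupChar_apply (χ j) C)).symm
        simp only [map_mul, MonoidHom.inv_apply, map_inv, Units.val_inv_eq_inv_val, map_inv₀, hu,
          inv_inv]
        ring
      have h0 := eq_zero_of_sum_add_inv_eq_zero χ hχ (fun j ↦ (starRingEnd ℂ) (pairing R₁ (φ j) z)) hz i
      have := congrArg (starRingEnd ℂ) h0
      simpa using this
    ext i : 1
    rw [WithLp.ofLp_zero, Pi.zero_apply]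
    exact eq_zero_of_pairing_eq_zero hR₁pos (fun z ↦ hpair i z)
  /- Step 3: the targets `Fᵢ = fᵢ − ∑_{p ≤ N} ∑_{𝔮 ∣ p} (−log(1 − χᵢ(𝔮) N𝔮^{-s}))` -/
  set P : Finset ℕ := (Finset.range (N + 1)).filter Nat.Prime with hP
  have hPprime : ∀ p ∈ P, p.Prime := fun p hp ↦ (Finset.mem_filter.1 hp).2
  have hPle : ∀ p ∈ P, p ≤ N := fun p hp ↦ by
    have := Finset.mem_range.1 (Finset.mem_filter.1 hp).1
    omega
  set F : ι → ℂ → ℂ := fun i s ↦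
    f i s - ∑ p ∈ P, ∑ Q ∈ primesOverNat K p, logTermI (χ i) 1 Q s with hF
  have hFd : ∀ i, DifferentiableOn ℂ (F i) (closedBall (σ₀ : ℂ) R₂) := by
    intro i
    refine ((hf i).mono hsub).sub (DifferentiableOn.fun_sum fun p hp ↦
      DifferentiableOn.fun_sum fun Q hQ ↦ ?_)
    intro s hs
    have hs0 : 0 < s.re := by linarith [hre s hs]
    exact (differentiableAt_logTermI (χ i) (by simp) (hPprime p hp) hQ hs0).differentiableWithinAt
  set TF : PiLp 2 (fun _ : ι ↦ lp (fun _ : ℕ ↦ ℂ) 2) :=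
    WithLp.toLp 2 (fun i ↦ targetVec hR₁pos (F i) (σ₀ : ℂ) hR₁R₂) with hTF
  have hTF_apply : ∀ i, TF i = targetVec hR₁pos (F i) (σ₀ : ℂ) hR₁R₂ := fun i ↦ rfl
  /- Step 4: Pechersky's theorem -/
  set Kc : ℝ := supConst r R₁ with hKc
  have hK0 : 0 ≤ Kc := supConst_nonneg hr.le hR₁pos
  have hη₁ : 0 < η / (3 * (Kc + 1)) := by positivity
  obtain ⟨mm, a, ha1, happ⟩ :=
    Literature.Analysis.Approximation.exists_unimodular_sum_range_near hx1 hx2 TF hη₁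
  /- Step 5: the set of primes (an initial segment) and the phases -/
  set M : Finset ℕ := P ∪ (Finset.range mm).image qq with hM
  set n : ℕ := if mm = 0 then N + 1 else qq (mm - 1) + 1 with hn
  have hnM : n.primesBelow = M := by
    rw [hn, hM]
    split_ifs with hmm
    · rw [hmm, Finset.range_zero, Finset.image_empty, Finset.union_empty, hP]
      ext p
      simp [Nat.mem_primesBelow, Finset.mem_filter]
    · exact primesBelow_eq_union_image N mm (Nat.pos_of_ne_zero hmm)
  have hyn : y ≤ n := by
    rw [hn]
    split_ifs with hmm
    · omega
    · have := hq_gt (mm - 1)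
      change N < qq (mm - 1) at this
      omega
  set b : ℕ → ℂ := fun p ↦ if h : p.Prime ∧ N < p then a ((enumAbove N).symm ⟨p, h⟩) else 1
    with hb
  have hb1 : ∀ p, ‖b p‖ = 1 := by
    intro p
    simp only [hb]
    split_ifs
    · exact ha1 _
    · simp
  have hb_small : ∀ p ∈ P, b p = 1 := by
    intro p hp
    have hpN : p ≤ N := hPle p hp
    simp only [hb]
    rw [dif_neg]
    exact fun h ↦ absurd h.2 (not_lt.2 hpN)
  have hb_q : ∀ n, b (qq n) = a n := by
    intro n
    simp only [hb]
    rw [dif_pos (enumAbove_spec N n)]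
    congr 1
    have : (⟨qq n, enumAbove_spec N n⟩ : primesAbove N) = enumAbove N n := Subtype.ext rfl
    rw [this, OrderIso.symm_apply_apply]
  refine ⟨n, hyn, b, hb1, fun i s hs ↦ ?_⟩
  rw [hnM]
  · /- Step 6: the estimate on `|s − σ₀| ≤ r`, component `i` -/
    have hs_norm : ‖s - σ₀‖ ≤ r := by rwa [mem_closedBall, dist_eq_norm] at hs
    have hs_ball : s ∈ ball (σ₀ : ℂ) R₂ := by
      rw [mem_ball, dist_eq_norm]; exact hs_norm.trans_lt (hrR₁.trans hR₁R₂)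
    have hs_re : 1 / 2 < s.re := hre s (ball_subset_closedBall hs_ball)
    have hs_re' : σ₀ - r ≤ s.re := by
      have h := (abs_re_le_norm (s - σ₀)).trans hs_norm
      rw [sub_re, ofReal_re, abs_le] at h
      linarith [h.1]
    -- split the sum over `M = P ∪ qq(range mm)`
    have hdisj : Disjoint P ((Finset.range mm).image qq) := by
      rw [Finset.disjoint_left]
      intro p hp hp'
      obtain ⟨n, -, rfl⟩ := Finset.mem_image.1 hp'
      exact absurd (hq_gt n) (not_lt.2 (hPle _ hp))
    set Sb : ℕ → ℂ := fun p ↦ ∑ Q ∈ primesOverNat K p, logTermI (χ i) (powPhase b (Ideal.absNorm Q)) Q s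
      with hSb
    have hsumM : ∑ p ∈ M, Sb p = (∑ p ∈ P, ∑ Q ∈ primesOverNat K p, logTermI (χ i) 1 Q s) +
        ∑ n ∈ Finset.range mm, Sb (qq n) := by
      rw [hM, Finset.sum_union hdisj, Finset.sum_image fun n₁ _ n₂ _ h ↦ hq_inj h]
      congr 1
      refine Finset.sum_congr rfl fun p hp ↦ Finset.sum_congr rfl fun Q hQ ↦ ?_
      exact logTermI_powPhase_eq_of_eq_one (hPprime p hp) (hb_small p hp) (χ i) hQ s
    -- (i) the Hilbert-space part, component `i`
    set v : PiLp 2 (fun _ : ι ↦ lp (fun _ : ℕ ↦ ℂ) 2) :=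
      TF - ∑ n ∈ Finset.range mm, a n • x n with hv
    have hv_apply : v i = targetVec hR₁pos (F i) (σ₀ : ℂ) hR₁R₂ -
        ∑ n ∈ Finset.range mm, (a n * aCoeff (χ i) (qq n)) •
          cpowVec R₁ hR₁pos (qq n) (hq_pos n) (σ₀ : ℂ) := by
      rw [hv, PiLp.sub_apply, hTF_apply]
      congr 1
      show WithLp.ofLp (∑ n ∈ Finset.range mm, a n • x n) i = _
      rw [WithLp.ofLp_sum, Finset.sum_apply]
      refine Finset.sum_congr rfl fun n _ ↦ ?_
      rw [WithLp.ofLp_smul, Pi.smul_apply]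
      show a n • (x n i) = _
      rw [hx_apply, smul_smul]
    have hseries : seriesOf R₁ (v i) (σ₀ : ℂ) s =
        F i s - ∑ n ∈ Finset.range mm, a n * aCoeff (χ i) (qq n) * (qq n : ℂ) ^ (-s) := by
      rw [hv_apply, seriesOf_sub hR₁pos hr.le hrR₁ _ _ hs_norm,
        seriesOf_finset_sum hR₁pos hr.le hrR₁ _ _ hs_norm,
        seriesOf_targetVec hR₁pos hR₁R₂ (hFd i) hs_ball]
      congr 1
      refine Finset.sum_congr rfl fun n _ ↦ ?_
      rw [seriesOf_smul, seriesOf_cpowVec hR₁pos (hq_pos n) (σ₀ : ℂ) s]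
    have hvnorm : ‖v i‖ ≤ ‖v‖ := PiLp.norm_apply_le v i
    have hpart1 : ‖F i s - ∑ n ∈ Finset.range mm,
        a n * aCoeff (χ i) (qq n) * (qq n : ℂ) ^ (-s)‖ < η / 3 := by
      rw [← hseries]
      calc ‖seriesOf R₁ (v i) (σ₀ : ℂ) s‖ ≤ Kc * ‖v i‖ := norm_seriesOf_le hR₁pos hr.le hrR₁ _ hs_norm
        _ ≤ Kc * ‖v‖ := mul_le_mul_of_nonneg_left hvnorm hK0
        _ ≤ Kc * (η / (3 * (Kc + 1))) := by gcongr
        _ < η / 3 := by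
            rw [mul_div_assoc']
            rw [div_lt_div_iff₀ (by positivity) (by positivity)]
            nlinarith
    -- (ii) the quadratic tails
    have hpart2 : ‖∑ n ∈ Finset.range mm,
        (Sb (qq n) - a n * aCoeff (χ i) (qq n) * (qq n : ℂ) ^ (-s))‖ < η / 3 := by
      have hterm : ∀ n ∈ Finset.range mm,
          ‖Sb (qq n) - a n * aCoeff (χ i) (qq n) * (qq n : ℂ) ^ (-s)‖ ≤ g (qq n) := by
        intro n _
        rw [hSb, ← hb_q n]
        refine (norm_sum_logTermI_sub_le h2 (χ i) hb1 (hq_prime n) hs_re).trans ?_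
        simp only [hg]
        gcongr
        · exact_mod_cast (hq_prime n).one_lt.le
        · rw [hc]; linarith
      calc ‖∑ n ∈ Finset.range mm, (Sb (qq n) - a n * aCoeff (χ i) (qq n) * (qq n : ℂ) ^ (-s))‖
          ≤ ∑ n ∈ Finset.range mm, g (qq n) := norm_sum_le_of_le _ hterm
        _ ≤ ∑' j : ℕ, g (j + (N + 1)) :=
            sum_enumAbove_le_tsum N hg0 ((summable_nat_add_iff (N + 1)).2 hgs) _
        _ < η / 3 := htailN
    -- assemble
    have hident : (∑ p ∈ M, Sb p) - f i s =
        -(F i s - ∑ n ∈ Finset.range mm, a n * aCoeff (χ i) (qq n) * (qq n : ℂ) ^ (-s)) +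
          ∑ n ∈ Finset.range mm,
            (Sb (qq n) - a n * aCoeff (χ i) (qq n) * (qq n : ℂ) ^ (-s)) := by
      rw [hsumM, hF, Finset.sum_sub_distrib]
      ring
    show ‖(∑ p ∈ M, Sb p) - f i s‖ < η
    rw [hident]
    calc ‖-(F i s - ∑ n ∈ Finset.range mm, a n * aCoeff (χ i) (qq n) * (qq n : ℂ) ^ (-s)) +
          ∑ n ∈ Finset.range mm, (Sb (qq n) - a n * aCoeff (χ i) (qq n) * (qq n : ℂ) ^ (-s))‖
        ≤ ‖-(F i s - ∑ n ∈ Finset.range mm, a n * aCoeff (χ i) (qq n) * (qq n : ℂ) ^ (-s))‖ +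
          ‖∑ n ∈ Finset.range mm, (Sb (qq n) - a n * aCoeff (χ i) (qq n) * (qq n : ℂ) ^ (-s))‖ :=
          norm_add_le _ _
      _ < η / 3 + η / 3 := by rw [norm_neg]; exact add_lt_add hpart1 hpart2
      _ ≤ η := by linarith

/-- The twisted local factor `1 − ν(𝔮) e N𝔮^{−s}` (`|e| ≤ 1`, `Re s > 0`) does not vanish.
[folklore] -/
theorem one_sub_zTerm_ne_zero (χ : ClassGroup (𝓞 K) →* ℂˣ) {e : ℂ} (he : ‖e‖ ≤ 1) {p : ℕ}
    (hp : p.Prime) {Q : Ideal (𝓞 K)} (hQ : Q ∈ primesOverNat K p) {s : ℂ} (hs : 0 < s.re) :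
    (1 : ℂ) - classGroupCharIdealHom χ Q * e * ((Ideal.absNorm Q : ℕ) : ℂ) ^ (-s) ≠ 0 := by
  have h2 := two_le_absNorm_of_mem_primesOverNat hp hQ
  have hpos : 0 < Ideal.absNorm Q := by omega
  intro h
  have hn : ‖classGroupCharIdealHom χ Q * e * ((Ideal.absNorm Q : ℕ) : ℂ) ^ (-s)‖ < 1 := by
    rw [norm_mul, norm_mul, Complex.norm_natCast_cpow_of_pos hpos, neg_re]
    have h1 : ((Ideal.absNorm Q : ℕ) : ℝ) ^ (-s.re) < 1 :=
      Real.rpow_lt_one_of_one_lt_of_neg (by exact_mod_cast (by omega : 1 < Ideal.absNorm Q))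
        (by linarith)
    calc ‖classGroupCharIdealHom χ Q‖ * ‖e‖ * ((Ideal.absNorm Q : ℕ) : ℝ) ^ (-s.re)
        ≤ 1 * 1 * ((Ideal.absNorm Q : ℕ) : ℝ) ^ (-s.re) := by
          gcongr
          · exact norm_classGroupCharIdealHom_le χ Q
      _ < 1 := by rw [one_mul, one_mul]; exact h1
  rw [sub_eq_zero] at h
  rw [← h, norm_one] at hn
  exact lt_irrefl _ hn

/-- **Joint denseness of twisted finite Euler products of class group `L`-functions on discs**
(quadratic field; pairwise non-equivalent characters; zero-free analytic targets): for
`0 < r < R`, `1/2 < σ₀ − r`, `σ₀ + r < 1`, `gᵢ` analytic and zero-free on `|s − σ₀| < R`,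
`ε > 0` and `y`, there are `n ≥ y` and unimodular `b_p` with
`‖gᵢ(s) − ∏_{p<n} ∏_{𝔮 ∣ p} (1 − χᵢ(𝔮) b_p^{f(𝔮)} N𝔮^{−s})⁻¹‖ < ε` for all `i`, `|s − σ₀| ≤ r`.
From `exists_joint_classLogSum_near` by composing with the exponential map (holomorphic logarithms
of the `gᵢ`), as in `JointDenseness.exists_joint_eulerProduct_near`.
[cite: Steuding2007, Thm. 5.10 and §1.4 Thm. 1.10] [cite: BayartMatheron2009, Cor. 11.17] -/
theorem exists_joint_classEulerProduct_near (h2 : Module.finrank ℚ K = 2) {ι : Type} [Fintype ι]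
    (χ : ι → (ClassGroup (𝓞 K) →* ℂˣ))
    (hχ : Pairwise fun i j ↦ χ i ≠ χ j ∧ χ i ≠ (χ j)⁻¹)
    (σ₀ r R : ℝ) (hr : 0 < r) (hrR : r < R) (h1 : 1 / 2 < σ₀ - r) (h1' : σ₀ + r < 1)
    (g : ι → ℂ → ℂ) (hg : ∀ i, DifferentiableOn ℂ (g i) (ball (σ₀ : ℂ) R))
    (hg0 : ∀ i, ∀ s ∈ ball (σ₀ : ℂ) R, g i s ≠ 0)
    (ε : ℝ) (hε : 0 < ε) (y : ℕ) :
    ∃ n : ℕ, y ≤ n ∧ ∃ b : ℕ → ℂ, (∀ p, ‖b p‖ = 1) ∧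
      ∀ i, ∀ s ∈ closedBall (σ₀ : ℂ) r,
        ‖g i s - ∏ p ∈ n.primesBelow, ∏ Q ∈ primesOverNat K p,
          (1 - classGroupCharIdealHom (χ i) Q * powPhase b (Ideal.absNorm Q) *
            ((Ideal.absNorm Q : ℕ) : ℂ) ^ (-s))⁻¹‖ < ε := by
  classical
  -- holomorphic logarithms of the targets on the ball
  have hlog : ∀ i, ∃ h : ℂ → ℂ, DifferentiableOn ℂ h (ball (σ₀ : ℂ) R) ∧
      ∀ z ∈ ball (σ₀ : ℂ) R, g i z = Complex.exp (h z) := fun i ↦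
    Complex.exists_eq_exp_of_forall_isExactOn isOpen_ball (convex_ball _ R).isPreconnected
      (fun F hF ↦ hF.isExactOn_ball) (hg i) (hg0 i)
  choose h hh hgh using hlog
  -- a common bound for `‖gᵢ‖` on the closed disc
  have hsub : closedBall (σ₀ : ℂ) r ⊆ ball (σ₀ : ℂ) R := closedBall_subset_ball hrR
  have hbd : ∀ i, ∃ C : ℝ, ∀ s ∈ closedBall (σ₀ : ℂ) r, ‖g i s‖ ≤ C := fun i ↦
    (isCompact_closedBall _ r).exists_bound_of_continuousOn ((hg i).continuousOn.mono hsub)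
  choose C hC using hbd
  set Bd : ℝ := ∑ i, |C i| with hBd
  have hBd0 : 0 ≤ Bd := Finset.sum_nonneg fun i _ ↦ abs_nonneg _
  have hgB : ∀ i, ∀ s ∈ closedBall (σ₀ : ℂ) r, ‖g i s‖ ≤ Bd := fun i s hs ↦
    ((hC i s hs).trans (le_abs_self _)).trans
      (Finset.single_le_sum (f := fun j ↦ |C j|) (fun j _ ↦ abs_nonneg _) (Finset.mem_univ i))
  -- the joint log-sum approximation
  set η : ℝ := min 1 (ε / (2 * (Bd + 1))) with hη
  have hη0 : 0 < η := lt_min one_pos (by positivity)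
  have hη1 : η ≤ 1 := min_le_left _ _
  have hηε : η ≤ ε / (2 * (Bd + 1)) := min_le_right _ _
  obtain ⟨n, hyn, b, hb1, happ⟩ :=
    exists_joint_classLogSum_near h2 χ hχ σ₀ r R hr hrR h1 h1' h hh η hη0 y
  refine ⟨n, hyn, b, hb1, fun i s hs ↦ ?_⟩
  have hsR : s ∈ ball (σ₀ : ℂ) R := hsub hs
  have hs_re : 0 < s.re := by
    rw [mem_closedBall, dist_eq_norm] at hs
    have h' := (abs_re_le_norm (s - σ₀)).trans hs
    rw [sub_re, ofReal_re, abs_le] at h'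
    linarith [h'.1]
  -- the product is `exp` of the log-sum
  set L : ℂ := ∑ p ∈ n.primesBelow, ∑ Q ∈ primesOverNat K p,
    logTermI (χ i) (powPhase b (Ideal.absNorm Q)) Q s with hL
  have hprod : ∏ p ∈ n.primesBelow, ∏ Q ∈ primesOverNat K p,
      (1 - classGroupCharIdealHom (χ i) Q * powPhase b (Ideal.absNorm Q) *
        ((Ideal.absNorm Q : ℕ) : ℂ) ^ (-s))⁻¹ = Complex.exp L := by
    rw [hL, Complex.exp_sum]
    refine Finset.prod_congr rfl fun p hp ↦ ?_
    rw [Complex.exp_sum]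
    refine Finset.prod_congr rfl fun Q hQ ↦ ?_
    have hpp : p.Prime := (Nat.mem_primesBelow.1 hp).2
    rw [logTermI, exp_neg_log_one_sub]
    exact one_sub_zTerm_ne_zero (χ i) (norm_powPhase hb1 _).le hpp hQ hs_re
  rw [hprod]
  -- compose with the exponential map
  have happs : ‖L - h i s‖ < η := happ i s hs
  have hexp : g i s - Complex.exp L = Complex.exp (h i s) * (1 - Complex.exp (L - h i s)) := by
    rw [hgh i s hsR, mul_sub, mul_one, ← Complex.exp_add, add_sub_cancel]
  calc ‖g i s - Complex.exp L‖ = ‖g i s‖ * ‖Complex.exp (L - h i s) - 1‖ := by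
        rw [hexp, norm_mul, ← hgh i s hsR, norm_sub_rev]
    _ ≤ Bd * (2 * ‖L - h i s‖) :=
        mul_le_mul (hgB i s hs) (Complex.norm_exp_sub_one_le (by linarith)) (norm_nonneg _) hBd0
    _ ≤ Bd * (2 * η) := by gcongr
    _ ≤ Bd * (ε / (Bd + 1)) := by
        gcongr
        calc 2 * η ≤ 2 * (ε / (2 * (Bd + 1))) := by gcongr
          _ = ε / (Bd + 1) := by field_simp
    _ < ε := by
        rw [mul_div_assoc', div_lt_iff₀ (by positivity)]
        nlinarith

end Literature.NumberTheory.LFunctions.NumberField
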